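import Mathlib
import HarnessLib
import Summits.HubbardSuperconductivity.HubbardSuperconductivity.Theorems.KLProgrammeH10TwoPointLimitPerturbedFermiRadiusAccel

/-!
# Route `KLProgramme` — crux K1 `H10TwoPointLimit` (stmt-HubbardSuperconductivity-19938):
# BGM (2.41) — second-order closeness of the perturbed Fermi curve to the free curve of the shifted level

The last piece of Lemma I (HOME/prover-p4/INVERSION-NOTE.md §2 (iii)): for a root selection `u` of `{ε₀ + δ = μ}` (`δ ∈ C²`, `|δ| ≤ κ₀`,
`‖Dδ‖ ≤ κ₁ < Dt_min`, `‖D(Dδ)‖ ≤ κ₂` on the closed square, `[μ - κ₀, μ + κ₀] ⊂ [a, b]`), at every angle the perturbed radius EQUALS the free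
radius `u_ν(θ)` of the shifted level `ν = μ - δ(u θ·dir θ)`, its slope is within `O(κ₁)` of `u_ν'(θ)` (`…PerturbedFermiRadiusSmooth`), and — this
file — its second derivative is within `O(κ₁ + κ₂)` of `u_ν''(θ) = bandRadiusDeriv2 ν θ`:

  `|u''(θ) - u_ν''(θ)| ≤ (κ₁ (4 C_V (S_E + s_max) + 8 C_V + 2 U₁ + π√2 + U₂) + κ₂ S_E²)/Dt_min`

(`abs_second_deriv_sub_bandRadiusDeriv2_le`), by subtracting the two solved level identities `radial_second_deriv_identity` (perturbed) and
`radial_second_deriv_identity_band` (free, at the level `ν`, SAME point and same `∂_tF`): the free terms cancel exactly and what remains is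
`-2cos X (X_E'² - X_ν'²) - 2cos Y (Y_E'² - Y_ν'²) - D²δ[v,v] + 4(u' - u_ν')(…) - 2u' Dδ[dir⊥] + u Dδ[dir] - Dδ[dir] u''`, each `O(κ₁)` or `O(κ₂)`
by the first-order closeness `abs_VXE_sub_bandVX_le` / `abs_deriv_sub_bandFermiRadiusDeriv_le_uniform` and the acceleration bound
`abs_second_deriv_le`. Constants: `C_V = (π√2 + 2 s_max)/(Dt_min - κ₁)`, `S_E = s_max + κ₁ C_V`, `U₁ = (4 + κ₁)π√2/(Dt_min - κ₁)`, `U₂` = the bound of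
`abs_second_deriv_le`. Hence the perturbed curve's `A₂`/convexity data are those of the free curve of the shifted level up to `O(κ₁ + κ₂)` — the
input of the fold analysis (`even_key`, `odd_transversal`) on the moving curve (PORT-NOTE (β)). Everything is PROVED; no definitions.
References: BGM 2006 §2.4 Lemma 2.1 (2.41) [cite: BenfattoGiulianiMastropietro2006].
-/

noncomputable section

namespace Summit.HubbardSuperconductivity.HubbardSuperconductivity.Theorems.PerturbedFermiCurve

set_option linter.dupNamespace false -- summit = problem name (single-conjunct summit), D-0017

open Real Set
open Literature.MathematicalPhysics.QuantumLattice Literature.MathematicalPhysics.QuantumLattice.BandSectorCounting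

section Close

variable {a b : ℝ} (B : BandBounds a b) {δ : (Fin 2 → ℝ) → ℝ} (hδs : ContDiff ℝ 2 δ)
  {κ₀ κ₁ κ₂ μ : ℝ} (hδ : ∀ k : Fin 2 → ℝ, (∀ i, |k i| ≤ π) → |δ k| ≤ κ₀) (hlo : a ≤ μ - κ₀) (hhi : μ + κ₀ ≤ b)
  (hκ : ∀ k : Fin 2 → ℝ, (∀ i, |k i| ≤ π) → ‖fderiv ℝ δ k‖ ≤ κ₁) (hκ₁ : κ₁ < B.Dtmin)
  (hκ₂ : ∀ k : Fin 2 → ℝ, (∀ i, |k i| ≤ π) → ‖fderiv ℝ (fderiv ℝ δ) k‖ ≤ κ₂)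
  {u : ℝ → ℝ} (hu : ∀ θ, IsBandFermiRadius (μ - δ (u θ • dir θ)) θ (u θ))
include B hδs hδ hlo hhi hκ hκ₁ hκ₂ hu

/-- **BGM (2.41): `|u'' - u_ν''| = O(κ₁ + κ₂)` at the shifted level**, with the explicit constant of the module docstring.
[cite: BenfattoGiulianiMastropietro2006, §2.4 Lemma 2.1 (2.41)] -/
theorem abs_second_deriv_sub_bandRadiusDeriv2_le (θ : ℝ) :
    |deriv (deriv u) θ - bandRadiusDeriv2 (μ - δ (u θ • dir θ)) θ| ≤
      (κ₁ * (4 * ((π * Real.sqrt 2 + 2 * B.smax) / (B.Dtmin - κ₁)) *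
              ((B.smax + κ₁ * (π * Real.sqrt 2 + 2 * B.smax) / (B.Dtmin - κ₁)) + B.smax) +
            8 * ((π * Real.sqrt 2 + 2 * B.smax) / (B.Dtmin - κ₁)) +
            2 * ((4 + κ₁) * (π * Real.sqrt 2) / (B.Dtmin - κ₁)) + π * Real.sqrt 2 +
            ((4 + κ₂) * (B.smax + κ₁ * (π * Real.sqrt 2 + 2 * B.smax) / (B.Dtmin - κ₁)) ^ 2 +
              (8 + 2 * κ₁) * ((4 + κ₁) * (π * Real.sqrt 2) / (B.Dtmin - κ₁)) + (4 + κ₁) * (π * Real.sqrt 2)) / (B.Dtmin - κ₁)) +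
        κ₂ * (B.smax + κ₁ * (π * Real.sqrt 2 + 2 * B.smax) / (B.Dtmin - κ₁)) ^ 2) / B.Dtmin := by
  have h2ne : (2 : WithTop ℕ∞) ≠ 0 := by norm_num
  -- constants
  set CV := (π * Real.sqrt 2 + 2 * B.smax) / (B.Dtmin - κ₁) with hCV
  set SE := B.smax + κ₁ * (π * Real.sqrt 2 + 2 * B.smax) / (B.Dtmin - κ₁) with hSE
  set U1 := (4 + κ₁) * (π * Real.sqrt 2) / (B.Dtmin - κ₁) with hU1
  set U2 := ((4 + κ₂) * SE ^ 2 + (8 + 2 * κ₁) * U1 + (4 + κ₁) * (π * Real.sqrt 2)) / (B.Dtmin - κ₁) with hU2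
  -- the data at `θ`
  set ν := μ - δ (u θ • dir θ) with hν
  have hsq := abs_apply_le_pi_of_isBandFermiRadius (hu θ)
  have hden : 0 < B.Dtmin - κ₁ := sub_pos.2 hκ₁
  have hDt := B.Dtmin_pos
  have hνmem : ν ∈ Icc a b := shiftedLevel_mem_Icc (hu θ) hδ hlo hhi
  obtain ⟨hν₁, hν₂⟩ := B.level hνmem
  have hur : u θ = bandFermiRadius ν θ := eq_bandFermiRadius_of_shifted B hδ hlo hhi (hu θ)
  obtain ⟨hXeq, hYeq⟩ := XE_eq_bandX_shifted B hδ hlo hhi hu θ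
  obtain ⟨hvx, hvy⟩ := abs_VXE_le B hδs h2ne hδ hlo hhi hκ hκ₁ hu θ
  obtain ⟨hdvx, hdvy⟩ := abs_VXE_sub_bandVX_le B hδs h2ne hδ hlo hhi hκ hκ₁ hu θ
  have hdu1 := abs_deriv_sub_bandFermiRadiusDeriv_le_uniform B hδs h2ne hδ hlo hhi hκ hκ₁ hu θ
  have hupos : 0 < u θ := (mem_Ioo_of_shifted B hδ hlo hhi (hu θ)).1
  have hule : u θ ≤ π * Real.sqrt 2 := root_le_pi_mul_sqrt_two B hδ hlo hhi hu θ
  have hκ₁0 : 0 ≤ κ₁ := le_trans (norm_nonneg _) (hκ _ hsq)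
  have hκ₂0 : 0 ≤ κ₂ := (norm_nonneg (fderiv ℝ (fderiv ℝ δ) (u θ • dir θ))).trans (hκ₂ _ hsq)
  have hSE0 : 0 ≤ SE := (abs_nonneg _).trans hvx
  have hu1 : |deriv u θ| ≤ U1 := by
    refine (abs_deriv_le B hδs h2ne hδ hlo hhi hκ hκ₁ hu θ).trans ?_
    rw [hU1]; exact div_le_div_of_nonneg_right (mul_le_mul_of_nonneg_left hule (by linarith)) hden.le
  have hU10 : 0 ≤ U1 := (abs_nonneg _).trans hu1
  have hu2b : |deriv (deriv u) θ| ≤ U2 := abs_second_deriv_le B hδs hδ hlo hhi hκ hκ₁ hκ₂ hu θ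
  have hsmx := B.abs_VX_le ν hνmem θ
  have hsmy := B.abs_VY_le ν hνmem θ
  -- the two identities
  have hroot : ∀ ϑ, sqDispersion (u ϑ • dir ϑ) + δ (u ϑ • dir ϑ) = μ := fun ϑ =>
    ((isBandFermiRadius_shifted_iff δ μ ϑ (u ϑ)).1 (hu ϑ)).2
  have hu2 : ContDiff ℝ 2 u := contDiff_of_isRoot B hδs h2ne hδ hlo hhi hκ hκ₁ hu
  have hE := radial_second_deriv_identity hδs hu2 hroot θ
  have hF := radial_second_deriv_identity_band hν₁ hν₂ θ
  rw [← hur, ← hXeq, ← hYeq] at hF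
  -- names
  set T := rayDispersionDt θ (u θ) with hT
  set Q := fderiv ℝ δ (u θ • dir θ) (dir θ) with hQ
  set Ap := fderiv ℝ δ (u θ • dir θ) (dir (θ + π / 2)) with hAp
  set D2 := fderiv ℝ (fderiv ℝ δ) (u θ • dir θ) ![VXE u θ, VYE u θ] ![VXE u θ, VYE u θ] with hD2
  set w := bandRadiusDeriv2 ν θ with hw
  have hTge : B.Dtmin ≤ T := Dtmin_le_rayDispersionDt_of_shifted B hδ hlo hhi (hu θ)
  have hTpos : 0 < T := hDt.trans_le hTge
  have hQ1 : |Q| ≤ κ₁ := abs_fderiv_dir_le (hκ _ hsq) θ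
  have hAp1 : |Ap| ≤ κ₁ := abs_fderiv_dir_le (hκ _ hsq) (θ + π / 2)
  have hv : ‖(![VXE u θ, VYE u θ] : Fin 2 → ℝ)‖ ≤ SE := norm_vec2_le hSE0 hvx hvy
  have hD2b : |D2| ≤ κ₂ * SE ^ 2 := by
    refine (abs_fderiv_fderiv_le (hκ₂ _ hsq) ![VXE u θ, VYE u θ] ![VXE u θ, VYE u θ]).trans ?_
    rw [sq, mul_assoc]
    exact mul_le_mul_of_nonneg_left (mul_le_mul hv hv (norm_nonneg _) hSE0) hκ₂0
  -- the difference identity: T (u'' - w) = …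
  have hdiff : T * (deriv (deriv u) θ - w) =
      -(2 * Real.cos (XE u θ) * (VXE u θ ^ 2 - bandVX ν θ ^ 2) + 2 * Real.cos (YE u θ) * (VYE u θ ^ 2 - bandVY ν θ ^ 2) + D2) +
        4 * (deriv u θ - bandFermiRadiusDeriv ν θ) * (Real.sin (XE u θ) * Real.sin θ - Real.sin (YE u θ) * Real.cos θ) -
        2 * deriv u θ * Ap + u θ * Q - Q * deriv (deriv u) θ := by
    linear_combination hE - hF
  -- bound each term
  have hcX := Real.abs_cos_le_one (XE u θ); have hcY := Real.abs_cos_le_one (YE u θ)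
  have hsX := Real.abs_sin_le_one (XE u θ); have hsY := Real.abs_sin_le_one (YE u θ)
  have hsθ := Real.abs_sin_le_one θ; have hcθ := Real.abs_cos_le_one θ
  have hCV0 : 0 ≤ CV := by rw [hCV]; have := B.smax_pos; positivity
  have hdvx' : |VXE u θ - bandVX ν θ| ≤ κ₁ * CV := by rw [hCV, mul_div_assoc']; exact hdvx
  have hdvy' : |VYE u θ - bandVY ν θ| ≤ κ₁ * CV := by rw [hCV, mul_div_assoc']; exact hdvy
  have hdu1' : |deriv u θ - bandFermiRadiusDeriv ν θ| ≤ κ₁ * CV := by rw [hCV, mul_div_assoc']; exact hdu1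
  have t1 : |2 * Real.cos (XE u θ) * (VXE u θ ^ 2 - bandVX ν θ ^ 2)| ≤ 2 * (κ₁ * CV) * (SE + B.smax) := by
    have hf : VXE u θ ^ 2 - bandVX ν θ ^ 2 = (VXE u θ - bandVX ν θ) * (VXE u θ + bandVX ν θ) := by ring
    rw [hf, abs_mul, abs_mul, abs_two, abs_mul]
    have hsum : |VXE u θ + bandVX ν θ| ≤ SE + B.smax := (abs_add_le _ _).trans (add_le_add hvx hsmx)
    have e : |VXE u θ - bandVX ν θ| * |VXE u θ + bandVX ν θ| ≤ (κ₁ * CV) * (SE + B.smax) :=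
      mul_le_mul hdvx' hsum (abs_nonneg _) (mul_nonneg hκ₁0 hCV0)
    have e2 : |Real.cos (XE u θ)| * (|VXE u θ - bandVX ν θ| * |VXE u θ + bandVX ν θ|) ≤ 1 * ((κ₁ * CV) * (SE + B.smax)) :=
      mul_le_mul hcX e (by positivity) zero_le_one
    linarith
  have t2 : |2 * Real.cos (YE u θ) * (VYE u θ ^ 2 - bandVY ν θ ^ 2)| ≤ 2 * (κ₁ * CV) * (SE + B.smax) := by
    have hf : VYE u θ ^ 2 - bandVY ν θ ^ 2 = (VYE u θ - bandVY ν θ) * (VYE u θ + bandVY ν θ) := by ring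
    rw [hf, abs_mul, abs_mul, abs_two, abs_mul]
    have hsum : |VYE u θ + bandVY ν θ| ≤ SE + B.smax := (abs_add_le _ _).trans (add_le_add hvy hsmy)
    have e : |VYE u θ - bandVY ν θ| * |VYE u θ + bandVY ν θ| ≤ (κ₁ * CV) * (SE + B.smax) :=
      mul_le_mul hdvy' hsum (abs_nonneg _) (mul_nonneg hκ₁0 hCV0)
    have e2 : |Real.cos (YE u θ)| * (|VYE u θ - bandVY ν θ| * |VYE u θ + bandVY ν θ|) ≤ 1 * ((κ₁ * CV) * (SE + B.smax)) :=
      mul_le_mul hcY e (by positivity) zero_le_one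
    linarith
  have t3 : |4 * (deriv u θ - bandFermiRadiusDeriv ν θ) * (Real.sin (XE u θ) * Real.sin θ - Real.sin (YE u θ) * Real.cos θ)| ≤
      8 * (κ₁ * CV) := by
    have hin : |Real.sin (XE u θ) * Real.sin θ - Real.sin (YE u θ) * Real.cos θ| ≤ 2 := by
      refine (abs_sub _ _).trans ?_
      rw [abs_mul, abs_mul]
      have e1 : |Real.sin (XE u θ)| * |Real.sin θ| ≤ 1 * 1 := mul_le_mul hsX hsθ (abs_nonneg _) zero_le_one
      have e2 : |Real.sin (YE u θ)| * |Real.cos θ| ≤ 1 * 1 := mul_le_mul hsY hcθ (abs_nonneg _) zero_le_one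
      linarith
    rw [abs_mul, abs_mul, show |(4:ℝ)| = 4 by norm_num]
    have e : |deriv u θ - bandFermiRadiusDeriv ν θ| * |Real.sin (XE u θ) * Real.sin θ - Real.sin (YE u θ) * Real.cos θ| ≤
        (κ₁ * CV) * 2 := mul_le_mul hdu1' hin (abs_nonneg _) (mul_nonneg hκ₁0 hCV0)
    linarith
  have t4 : |2 * deriv u θ * Ap| ≤ 2 * U1 * κ₁ := by
    rw [abs_mul, abs_mul, abs_two]
    have e : |deriv u θ| * |Ap| ≤ U1 * κ₁ := mul_le_mul hu1 hAp1 (abs_nonneg _) hU10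
    linarith
  have t5 : |u θ * Q| ≤ π * Real.sqrt 2 * κ₁ := by
    rw [abs_mul, abs_of_pos hupos]; exact mul_le_mul hule hQ1 (abs_nonneg _) (by positivity)
  have t6 : |Q * deriv (deriv u) θ| ≤ κ₁ * U2 := by
    rw [abs_mul]; exact mul_le_mul hQ1 hu2b (abs_nonneg _) hκ₁0
  -- assemble
  have hR : |T * (deriv (deriv u) θ - w)| ≤
      κ₁ * (4 * CV * (SE + B.smax) + 8 * CV + 2 * U1 + π * Real.sqrt 2 + U2) + κ₂ * SE ^ 2 := by
    rw [hdiff]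
    have a1 := abs_add_le (2 * Real.cos (XE u θ) * (VXE u θ ^ 2 - bandVX ν θ ^ 2))
      (2 * Real.cos (YE u θ) * (VYE u θ ^ 2 - bandVY ν θ ^ 2))
    have a2 := abs_add_le (2 * Real.cos (XE u θ) * (VXE u θ ^ 2 - bandVX ν θ ^ 2) +
      2 * Real.cos (YE u θ) * (VYE u θ ^ 2 - bandVY ν θ ^ 2)) D2
    have a3 := abs_add_le (-(2 * Real.cos (XE u θ) * (VXE u θ ^ 2 - bandVX ν θ ^ 2) +
        2 * Real.cos (YE u θ) * (VYE u θ ^ 2 - bandVY ν θ ^ 2) + D2))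
      (4 * (deriv u θ - bandFermiRadiusDeriv ν θ) * (Real.sin (XE u θ) * Real.sin θ - Real.sin (YE u θ) * Real.cos θ))
    rw [abs_neg] at a3
    have a4 := abs_sub (-(2 * Real.cos (XE u θ) * (VXE u θ ^ 2 - bandVX ν θ ^ 2) +
        2 * Real.cos (YE u θ) * (VYE u θ ^ 2 - bandVY ν θ ^ 2) + D2) +
      4 * (deriv u θ - bandFermiRadiusDeriv ν θ) * (Real.sin (XE u θ) * Real.sin θ - Real.sin (YE u θ) * Real.cos θ))
      (2 * deriv u θ * Ap)
    have a5 := abs_add_le (-(2 * Real.cos (XE u θ) * (VXE u θ ^ 2 - bandVX ν θ ^ 2) +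
        2 * Real.cos (YE u θ) * (VYE u θ ^ 2 - bandVY ν θ ^ 2) + D2) +
      4 * (deriv u θ - bandFermiRadiusDeriv ν θ) * (Real.sin (XE u θ) * Real.sin θ - Real.sin (YE u θ) * Real.cos θ) -
      2 * deriv u θ * Ap) (u θ * Q)
    have a6 := abs_sub (-(2 * Real.cos (XE u θ) * (VXE u θ ^ 2 - bandVX ν θ ^ 2) +
        2 * Real.cos (YE u θ) * (VYE u θ ^ 2 - bandVY ν θ ^ 2) + D2) +
      4 * (deriv u θ - bandFermiRadiusDeriv ν θ) * (Real.sin (XE u θ) * Real.sin θ - Real.sin (YE u θ) * Real.cos θ) -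
      2 * deriv u θ * Ap + u θ * Q) (Q * deriv (deriv u) θ)
    linarith [t1, t2, t3, t4, t5, t6, hD2b, a1, a2, a3, a4, a5, a6]
  -- divide by `T ≥ Dt_min`
  rw [abs_mul, abs_of_pos hTpos] at hR
  rw [le_div_iff₀ hDt]
  have h0 : 0 ≤ |deriv (deriv u) θ - w| := abs_nonneg _
  calc |deriv (deriv u) θ - w| * B.Dtmin ≤ |deriv (deriv u) θ - w| * T := mul_le_mul_of_nonneg_left hTge h0
    _ = T * |deriv (deriv u) θ - w| := by ring
    _ ≤ _ := hR

end Close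

end Summit.HubbardSuperconductivity.HubbardSuperconductivity.Theorems.PerturbedFermiCurve

end
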